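import Summits.HodgeConjecture.HodgeConjecture.Theorems.Ring2TransportWeilRungsOfRiemann
import Summits.HodgeConjecture.HodgeConjecture.Theorems.Ring2TransportRiemannCommutantSpan
import Literature.AlgebraicGeometry.HodgeTheory.AbelianVarietyHodgeFullnessHolds
import Literature.AlgebraicGeometry.HodgeTheory.CMTypeIffMumfordTateCommutative
import HarnessLib

/-!
# Ring 2 transport — the residual R and node 44 HOLD (Riemann's theorem is now a tree theorem)

research route conditional on HC_CM; not a corollary; Q11.4-sentence-2 already refuted in dim ≥ 3.

Cell `pub-hodge-ring2`, seat `transport`, gen 60 (rev. gen 129: the four §1/§2 instance forms became ALIASES of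
Literature theorems; locator erratum — see GEN 129 below); helper file riding `--supports` the umbrella
`Theses.RankFourFaces.CMToAbelian` (stmt-HodgeConjecture-16267). `HC_CM` := the tree item
`Theses.RankFourFaces.CMAbelianHodge` (stmt-HodgeConjecture-3052), an explicit HYPOTHESIS, one side of an `↔`, or
the CONCLUSION of an implication from open inputs below — never a cited fact, never "known".

EVENT (cell `pub-hodgecm2`, 2026-08-21T01:17Z, p244037 commit 44b62b984c8f): the Literature record of Riemann's
theorem in the Deligne–Milne form, `HodgeTheory.DeligneMilne1982_Thm_6_20_full` (LNM 900 II Thm. 6.20, fullness of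
`A ↦ H¹_B(A)`), is a THEOREM of the tree — `HodgeTheory.deligneMilne1982_Thm_6_20_full_holds`
(`Literature/AlgebraicGeometry/HodgeTheory/AbelianVarietyHodgeFullnessHolds.lean`; uniformisation of complex abelian
varieties from [LangeBirkenhake1992] Lemma 1.1.2 `Kaehler.langeBirkenhake_lemma_1_1_2_weak`, lattice coordinates on
`H¹`, GAGA for maps; axioms `propext`, `Classical.choice`, `Quot.sound`). That record was the ONLY hypothesis of

* gen 52's edge `hodgeGroupH1CommutantSpan_of_riemann : DeligneMilne1982_Thm_6_20_full → HodgeGroupH1CommutantSpan`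
  (R, gen 51: the commutant of the tree's Tannaka-free `Hg(A)(ℂ)` on `H¹(A(ℂ); ℂ)` is `ℂ`-spanned by the pull-backs
  `φ^*`, `φ ∈ End A` — Deligne I §3 Prop. 3.4 + §5 proof of Prop. 5.1 «E is the commutant of G»), and of
* `cmTypeIffMumfordTateCommutative_of_riemann : DeligneMilne1982_Thm_6_20_full → CMTypeIffMumfordTateCommutative`
  (node 44, referee C7 / H-CM: «an abelian variety is of CM-type iff its Mumford–Tate group is a torus»,
  Deligne I §5 Prop. 5.1; Lange 2023 Prop. 7.2.6),
* and the binder `hR` of every row of `Ring2TransportWeilRungsOfRiemann` ((T5_R), (T1_R), (G_R), §4).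

This file applies those theorems to the closed term, BY NAME (count once: the discharge is p244037's, cell
`pub-hodgecm2`; the edges are gens 50–53's). WHAT IS PROVED (theorems only: 0 `def`, 0 new fact, 0 `sorry`):

* §1 `hodgeGroupH1CommutantSpan_holds : HodgeGroupH1CommutantSpan` — R is a THEOREM; pointwise and `↔` forms
  (`mem_span_complexBetti_map_of_commute_hodgeGroup`, `mem_span_complexBetti_map_iff_commute_hodgeGroup`: the
  commutant of `Hg(A)(ℂ)|_{H¹}` IS `End⁰(A) ⊗ ℂ`; the `↔` form is, since gen 129, an ALIAS of the Literature theorem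
  `HodgeTheory.mem_span_complexBetti_map_iff_commute_hodgeGroup` — see GEN 129 below).
* §2 `cmTypeIffMumfordTateCommutative_holds : CMTypeIffMumfordTateCommutative` — node 44 is a THEOREM (its `def` in
  `Ring2TransportCMDensity` is untouched; a `_holds` term of its exact type); instance forms
  `isOfCMType_iff_mumfordTateGroup_comm`, `isOfCMType_iff_hodgeGroup_comm` (Lange 2023 Prop. 7.2.6 (i) ⟺ (ii)),
  `isOfCMType_of_hodgeGroup_comm_holds` — since gen 129 ALIASES of the Literature theorems
  `HodgeTheory.isOfCMType_iff_mumfordTateGroup_comm`, `HodgeTheory.isOfCMType_iff_hodgeGroup_comm`,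
  `HodgeTheory.isOfCMType_of_hodgeGroup_comm` (same statements).
* §3 the rows of `Ring2TransportWeilRungsOfRiemann` with `hR` DISCHARGED: (T5) `HC_CM ↔ R3` granted the two CM-field
  transport leaves ONLY (`HC_CM_iff_weilClassesCMField_of_transport[_local]`); (T1) `R3 ⟹ R∞` granted the two
  quadratic leaves (`weilClassesImaginaryQuadratic_of_weilClassesCMField_of_transport[_local]`); (G) `HC_CM` as the
  CONCLUSION from TWO open transport inputs {Weil-divisorial CM-pointed `K`-Weil families, one CM-field transport
  leaf} (`HC_CM_of_weilDivisorialCMPointed_of_variational`, `…_local`); §4's two-rung equivalence on the four leaves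
  alone (`HC_CM_iff_weilRungs_of_transport`, `weilRungs_iff_weilClassesCMField_of_transport`).

HONEST ACCOUNTING. R and node 44 are statements about Hodge groups and CM-type — NOT cases of the Hodge conjecture;
no on-path lemma; `HC_CM` occurs in §§1–2 nowhere. In §3 every transport / anchor leaf (`CMPointedWeilFamilies*`,
`WeilVariationalHodge*`, `LocalWeilVHCAtCM*`, `WeilDivisorialCMPointedWeilFamiliesCMField`) is a Summit-side
`@[conjecture]` definition, OPEN as typed (Weil-confined variational Hodge is the whole difficulty); both sides of
every `↔` are open statements; (G) is a kernel-checked IMPLICATION from open inputs, not a proof sketch of `HC_CM`;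
NO case of the Hodge conjecture is proved here. The `←` halves of (T5) use no transport leaf: they are cell
`pub-hodgecm2`'s André road `CorCM.AndreWeakForm.hc_cm_of_riemann_of_weilClassesCMField` at the closed Riemann
term (their theorem, not re-minted under a transport name). Preprints cited for shape are UNREFEREED and inputs
of no theorem.

GEN 129 (2026-08-22; gate `dedup.landed` on p325147). Lane `lit-hodgefound` landed the Literature record
`Literature/AlgebraicGeometry/HodgeTheory/CMTypeIffMumfordTateCommutative.lean` (2026-08-21; Deligne I §5 Prop. 5.1,
Lange 2023 Prop. 7.2.5–7.2.6; sorry-free, Riemann entering through `Deligne1982.mem_span_complexBetti_map_of_commute_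
hodgeGroup`), whose theorems `HodgeTheory.mem_span_complexBetti_map_iff_commute_hodgeGroup`,
`HodgeTheory.isOfCMType_iff_mumfordTateGroup_comm`, `HodgeTheory.isOfCMType_of_hodgeGroup_comm` and
`HodgeTheory.isOfCMType_iff_hodgeGroup_comm` have VERBATIM the statements of this file's gen-60 §1/§2 instance forms
(its docstring: «the Summits copies are to become aliases of these»). Accordingly the four gen-60 theorems are now
`alias`es of those Literature declarations (names and statements unchanged, proof terms = the Literature constants;
count once: the Literature lane's). The transport axis's own derivations — `hodgeGroupH1CommutantSpan_holds`, its
pointwise form, `cmTypeIffMumfordTateCommutative_holds` (gens 50–52's edges at Riemann's record) — and all of §3–§4 are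
untouched. Same pass, locator erratum for [Markman2025SecantRealMultiplication] (arXiv:2509.23079, unrefereed; shape
only): the held copy's corollary numbered «11.2.4» is PRINTED Cor. 10.2.3 (p. 34) — docstring of (T1) below; no
statement, name or count moved.

References: P. Deligne, *Hodge cycles on abelian varieties*, LNM 900 (1982), I §3 Prop. 3.4, I §5 Prop. 5.1, I §6
proof of Prop. 6.1 [Deligne1982HodgeCycles]; P. Deligne, J. Milne, *Tannakian categories*, LNM 900 (1982), II
Thm. 6.20 [DeligneMilne1982Tannakian]; H. Lange, Ch. Birkenhake, *Complex Abelian Varieties* (1992), Lemma 1.1.2,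
Thm. 1.1.21 [LangeBirkenhake1992]; H. Lange, *Abelian Varieties over the Complex Numbers* (2023), Prop. 7.2.5,
Prop. 7.2.6 [Lange2023AbelianVarietiesComplex]; Y. André, *Une remarque à propos des cycles de Hodge de type CM*
(1992) [Andre1992HodgeCM]; A. Weil, *Abelian varieties and the Hodge ring* (1977) [Weil1977HodgeRing].
-/

set_option linter.dupNamespace false

noncomputable section

namespace Summit.HodgeConjecture.HodgeConjecture.Ring2Transport

open CategoryTheory
open Literature.AlgebraicGeometry Literature.AlgebraicGeometry.Motives
open Literature.AlgebraicGeometry.HodgeTheory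
open Summit.HodgeConjecture.HodgeConjecture.WeilTypeLadder
open Summit.HodgeConjecture.HodgeConjecture.Theses

/-! ## §1 The residual R is a theorem -/

/-- **R HOLDS: the commutant of `Hg(A)(ℂ)` on `H¹(A(ℂ); ℂ)` is spanned by the pull-backs `φ^*`, `φ ∈ End A`**
(`HodgeGroupH1CommutantSpan`, gen 51) — gen 52's edge `hodgeGroupH1CommutantSpan_of_riemann` (Deligne I §3 Prop. 3.4:
`Aut(ℂ)`-stability of `Hg` + Galois descent + the torus element `T_{2,1/2} ∈ Hg`; then Riemann) at the tree theorem
`deligneMilne1982_Thm_6_20_full_holds` (p244037). [cite: Deligne1982HodgeCycles, I §3 Prop. 3.4 and I §5 Prop. 5.1 (proof)]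
[cite: DeligneMilne1982Tannakian, II Thm. 6.20] [cite: Lange2023AbelianVarietiesComplex, Prop. 7.2.5] -/
theorem hodgeGroupH1CommutantSpan_holds : HodgeGroupH1CommutantSpan :=
  hodgeGroupH1CommutantSpan_of_riemann deligneMilne1982_Thm_6_20_full_holds

variable {A : AbelianVariety ℂ}

/-- R, pointwise: a `ℂ`-endomorphism of `H¹(A(ℂ); ℂ)` commuting with `Hg(A)(ℂ)|_{H¹}` lies in the `ℂ`-span of the
pull-backs along `End A`. [cite: Deligne1982HodgeCycles, I §5 Prop. 5.1 (proof: "E is the commutant of G")] -/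
theorem mem_span_complexBetti_map_of_commute_hodgeGroup {x : complexBetti A.X 1 →ₗ[ℂ] complexBetti A.X 1}
    (hx : ∀ g ∈ hodgeGroup A.dim A.X, ∀ y : complexBetti A.X 1, x (g 1 y) = g 1 (x y)) :
    x ∈ Submodule.span ℂ (Set.range fun φ : (A ⟶ A) => (complexBetti.map φ.hom.hom.hom 1).hom) :=
  hodgeGroupH1CommutantSpan_holds A x hx

/-- **`End⁰(A) ⊗ ℂ` IS the commutant of `Hg(A)(ℂ)` on `H¹`** (both inclusions: R and gen 51's unconditional
`commute_hodgeGroup_of_mem_span_complexBetti_map`). Lange 2023 Prop. 7.2.5 «`End_ℚ(X) ≃ End(V)^{Hg(X)}`», tensored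
with `ℂ` and transposed to `H¹ = V^*`. Since gen 129 an ALIAS of the Literature theorem of the same name in `HodgeTheory`
(`CMTypeIffMumfordTateCommutative.lean`, lane `lit-hodgefound`; same statement; gate `dedup.landed`, p325147; count
once: the Literature lane's). [cite: Lange2023AbelianVarietiesComplex, Prop. 7.2.5]
[cite: Deligne1982HodgeCycles, I §5 Prop. 5.1 (proof)] -/
alias mem_span_complexBetti_map_iff_commute_hodgeGroup :=
  Literature.AlgebraicGeometry.HodgeTheory.mem_span_complexBetti_map_iff_commute_hodgeGroup

/-! ## §2 Node 44 (H-CM, referee C7) is a theorem -/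

/-- **NODE 44 HOLDS: «an abelian variety is of CM-type iff its Mumford–Tate group is commutative»**
(`CMTypeIffMumfordTateCommutative`, verbatim the `@[conjecture] def` of `Ring2TransportCMDensity`, untouched) —
`cmTypeIffMumfordTateCommutative_of_riemann` (gen 50 `→`, gens 51–52 `←` modulo R modulo Riemann) at
`deligneMilne1982_Thm_6_20_full_holds`. Deligne, LNM 900 I §6 proof of Prop. 6.1: "Recall (§5) that an abelian
variety is of CM-type if and only if its Mumford-Tate group is a torus." NOT a case of HC; no on-path lemma.
[cite: Deligne1982HodgeCycles, I §5 Prop. 5.1 and I §6 proof of Prop. 6.1 (orig. p. 61; re-ed. p. 42)]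
[cite: Lange2023AbelianVarietiesComplex, Prop. 7.2.6 and Rem. 7.2.2 (2)] [cite: DeligneMilne1982Tannakian, II Thm. 6.20] -/
theorem cmTypeIffMumfordTateCommutative_holds : CMTypeIffMumfordTateCommutative :=
  cmTypeIffMumfordTateCommutative_of_riemann deligneMilne1982_Thm_6_20_full_holds

/-- Node 44 at an abelian variety: `IsOfCMType A ↔ MT(A)(ℂ)` commutative. Since gen 129 an ALIAS of the
Literature theorem of the same name in `HodgeTheory` (same statement; count once: lane `lit-hodgefound`'s).
[cite: Deligne1982HodgeCycles, I §5 Prop. 5.1] -/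
alias isOfCMType_iff_mumfordTateGroup_comm :=
  Literature.AlgebraicGeometry.HodgeTheory.isOfCMType_iff_mumfordTateGroup_comm

/-- **A commutative Hodge group forces CM-type**, unconditional (gen 51's `isOfCMType_of_hodgeGroup_comm` at R). Since
gen 129 an ALIAS of the Literature theorem `HodgeTheory.isOfCMType_of_hodgeGroup_comm` (same statement; count once:
lane `lit-hodgefound`'s); the name `Ring2Transport.isOfCMType_of_hodgeGroup_comm` stays gen 51's edge CONDITIONAL on R.
[cite: Deligne1982HodgeCycles, I §5 Prop. 5.1 (proof, direction ⇒)] [cite: MumfordAV1970, §19 Cor. 2 of Thm. 1] -/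
alias isOfCMType_of_hodgeGroup_comm_holds := Literature.AlgebraicGeometry.HodgeTheory.isOfCMType_of_hodgeGroup_comm

/-- **Lange 2023 Prop. 7.2.6, (i) ⟺ (ii): `Hg(A)(ℂ)` is commutative iff `End⁰(A)` contains a commutative semisimple
`ℚ`-algebra of dimension `2 dim A`** (`IsOfCMType A`). Since gen 129 an ALIAS of the Literature theorem of the same
name in `HodgeTheory` (same statement; count once: lane `lit-hodgefound`'s; `→` was gen 50's `hodgeGroup_comm_of_isOfCMType`).
[cite: Lange2023AbelianVarietiesComplex, Prop. 7.2.6] [cite: Mumford1969NoteShimura, §2] -/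
alias isOfCMType_iff_hodgeGroup_comm := Literature.AlgebraicGeometry.HodgeTheory.isOfCMType_iff_hodgeGroup_comm

/-! ## §3 The rows of `Ring2TransportWeilRungsOfRiemann` with Riemann's record discharged

Every theorem below is the gen-53 row of the same name-stem with `hR := deligneMilne1982_Thm_6_20_full_holds`;
the remaining binders are the OPEN transport / anchor leaves, and `HC_CM` is a side of an `↔` or a conclusion. -/

/-- **(T5) `HC_CM ↔ R3` granted the two CM-field transport leaves ONLY** (CM-pointed `K`-Weil families `hP₃` and
Weil-confined variational Hodge `hV₃` for CM fields of degree `> 2`). `→` = `HC_WeilClassesCMField_of_HC_CM`;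
`←` uses neither leaf (André's road at the closed Riemann term, cell `pub-hodgecm2`). CONDITIONAL on `hP₃`, `hV₃`;
both sides open. [cite: Andre1992HodgeCM, p. 2 and Théorème] [cite: DeligneMilne1982Tannakian, II Thm. 6.20]
[cite: Markman2025SurveySecant, Thm. 1.4 and §12 (preprint / ICM 2026 lecture, unrefereed; shape only)] -/
theorem HC_CM_iff_weilClassesCMField_of_transport
    (hP₃ : CMPointedWeilFamiliesCMField) (hV₃ : WeilVariationalHodgeCMField) :
    Theses.RankFourFaces.CMAbelianHodge ↔ WeilClassesCMField :=
  HC_CM_iff_weilClassesCMField_of_riemann_of_transport deligneMilne1982_Thm_6_20_full_holds hP₃ hV₃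

/-- (T5) with the local germ of algebraic fibres at CM-charted fibres (`LocalWeilVHCAtCMField`) for `hV₃`.
CONDITIONAL on `hP₃`, `hL`. [cite: Andre1992HodgeCM, p. 2] [cite: BuchweitzFlenner2003, Thm. 5.1 and Thm. 5.2] -/
theorem HC_CM_iff_weilClassesCMField_of_transport_local
    (hP₃ : CMPointedWeilFamiliesCMField) (hL : LocalWeilVHCAtCMField) :
    Theses.RankFourFaces.CMAbelianHodge ↔ WeilClassesCMField :=
  HC_CM_iff_weilClassesCMField_of_riemann_of_transport_local deligneMilne1982_Thm_6_20_full_holds hP₃ hL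

/-- **(T1) R3 ⟹ R∞ through `HC_CM`**, granted the two QUADRATIC transport leaves only: the Weil classes of CM fields
of degree `> 2` imply Weil's 1977 question for every imaginary quadratic field, every `n ≥ 2`, every discriminant
(then everything below R∞ by `Theorems/WeilTypeLadderOnPath`). Not a specialisation (`2 < e` in R3).
CONDITIONAL on `hP₂`, `hV₂`. [cite: Andre1992HodgeCM, p. 2] [cite: Weil1977HodgeRing, pp. 421–429]
[cite: Markman2025SecantRealMultiplication, Cor. 10.2.3 (preprint, unrefereed; shape only)] -/
theorem weilClassesImaginaryQuadratic_of_weilClassesCMField_of_transport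
    (hP₂ : CMPointedWeilFamiliesQuadratic) (hV₂ : WeilVariationalHodgeQuadratic) (h₃ : WeilClassesCMField) :
    WeilClassesImaginaryQuadratic :=
  weilClassesImaginaryQuadratic_of_riemann_of_weilClassesCMField deligneMilne1982_Thm_6_20_full_holds hP₂ hV₂ h₃

/-- (T1) with the local germ `LocalWeilVHCAtCMQuadratic` for `hV₂`. CONDITIONAL on `hP₂`, `hL`.
[cite: Andre1992HodgeCM, p. 2] [cite: BuchweitzFlenner2003, Thm. 5.1 and Thm. 5.2] -/
theorem weilClassesImaginaryQuadratic_of_weilClassesCMField_of_transport_local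
    (hP₂ : CMPointedWeilFamiliesQuadratic) (hL : LocalWeilVHCAtCMQuadratic) (h₃ : WeilClassesCMField) :
    WeilClassesImaginaryQuadratic :=
  weilClassesImaginaryQuadratic_of_riemann_of_weilClassesCMField_local deligneMilne1982_Thm_6_20_full_holds hP₂ hL h₃

/-- **(G) `HC_CM` as the CONCLUSION from TWO open transport inputs** (was three in gen 53, five in gen 19):
Weil-divisorial CM-pointed `K`-Weil families for CM fields (`hP₃`; `HC_CM`-free by Lefschetz (1,1)) and Weil-confined
variational Hodge for CM fields (`hV₃`) ⟹ `HC_CM`. HONEST: a kernel-checked IMPLICATION from OPEN inputs (VHC on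
Weil families is the whole difficulty), not a proof sketch of `HC_CM`; no case of HC is proved. Divisor-generated /
diagonal anchors: precompose `hP₃` with `weilDivisorialCMPointed_of_divisorGeneratedCMPointed` /
`weilDivisorialCMPointed_of_diagonalCMPointed`. [cite: Andre1992HodgeCM, p. 2 and Théorème]
[cite: Deligne1982HodgeCycles, §4–5] [cite: DeligneMilne1982Tannakian, II Thm. 6.20]
[cite: Markman2025SurveySecant, Thm. 1.4 and §12 (preprint / ICM 2026 lecture, unrefereed; strategy only)] -/
theorem HC_CM_of_weilDivisorialCMPointed_of_variational
    (hP₃ : WeilDivisorialCMPointedWeilFamiliesCMField) (hV₃ : WeilVariationalHodgeCMField) :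
    Theses.RankFourFaces.CMAbelianHodge :=
  HC_CM_of_riemann_of_weilDivisorialCMPointed_of_variational deligneMilne1982_Thm_6_20_full_holds hP₃ hV₃

/-- (G) with the local germ at CM fibres (`LocalWeilVHCAtCMField`) for `hV₃`. Same honesty clause.
[cite: Andre1992HodgeCM, p. 2] [cite: BuchweitzFlenner2003, Thm. 5.1] [cite: CharlesSchnell2014Notes, Prop. 11.3.11 (proof)] -/
theorem HC_CM_of_weilDivisorialCMPointed_local
    (hP₃ : WeilDivisorialCMPointedWeilFamiliesCMField) (hL : LocalWeilVHCAtCMField) :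
    Theses.RankFourFaces.CMAbelianHodge :=
  HC_CM_of_riemann_of_weilDivisorialCMPointed_local deligneMilne1982_Thm_6_20_full_holds hP₃ hL

/-- **§4 `HC_CM ↔ R∞ ∧ R3` granted the FOUR transport leaves alone** (gen 19's `HC_CM_iff_weilRungs_of_andre_of_transport`
with André's record AND Riemann's record now tree theorems). CONDITIONAL on the four named leaves.
[cite: Andre1992HodgeCM, Théorème (pp. 4–5)] [cite: DeligneMilne1982Tannakian, II Thm. 6.20]
[cite: Markman2025SurveySecant, Thm. 1.4 and §12 (preprint / ICM 2026 lecture, unrefereed)] -/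
theorem HC_CM_iff_weilRungs_of_transport
    (hP₂ : CMPointedWeilFamiliesQuadratic) (hV₂ : WeilVariationalHodgeQuadratic)
    (hP₃ : CMPointedWeilFamiliesCMField) (hV₃ : WeilVariationalHodgeCMField) :
    Theses.RankFourFaces.CMAbelianHodge ↔ WeilClassesImaginaryQuadratic ∧ WeilClassesCMField :=
  HC_CM_iff_weilRungs_of_riemann_of_transport deligneMilne1982_Thm_6_20_full_holds hP₂ hV₂ hP₃ hV₃

/-- Consistency of (T5) and §4: granted the quadratic leaves, the R∞-conjunct of §4 is REDUNDANT (R∞ ⟸ R3, (T1)).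
[cite: Andre1992HodgeCM, p. 2] -/
theorem weilRungs_iff_weilClassesCMField_of_transport
    (hP₂ : CMPointedWeilFamiliesQuadratic) (hV₂ : WeilVariationalHodgeQuadratic) :
    (WeilClassesImaginaryQuadratic ∧ WeilClassesCMField) ↔ WeilClassesCMField :=
  weilRungs_iff_weilClassesCMField_of_riemann_of_transport deligneMilne1982_Thm_6_20_full_holds hP₂ hV₂

end Summit.HodgeConjecture.HodgeConjecture.Ring2Transport

/-! ## Audit: R and node 44 carry NO hypothesis; (G) carries exactly its two open transport leaves; std axioms
(a `sorryAx` or a non-standard axiom anywhere in the closure of p244037 or of the transport axis would show here);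
`isOfCMType_iff_hodgeGroup_comm` is the gen-129 alias, so its line audits the Literature theorem's closure. -/

#print axioms Summit.HodgeConjecture.HodgeConjecture.Ring2Transport.hodgeGroupH1CommutantSpan_holds
#print axioms Summit.HodgeConjecture.HodgeConjecture.Ring2Transport.cmTypeIffMumfordTateCommutative_holds
#print axioms Summit.HodgeConjecture.HodgeConjecture.Ring2Transport.isOfCMType_iff_hodgeGroup_comm
#print axioms Summit.HodgeConjecture.HodgeConjecture.Ring2Transport.HC_CM_of_weilDivisorialCMPointed_of_variational

end
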